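import Summits.ValiantsHypothesis.ValiantsHypothesis.Theorems.GrenetZeonDualUnipotentThreeHalvesLongMassLedgerTorusCurve

/-!
# PARTS IV (monomial count) + V (Slow is closed along polynomial curves) — Theorems-side port of val-idea-28 g5's staged `…LongMassLedgerTorus.lean` (sha16 98392e2975984a00, 1360 l., 84 decls;
# itself the verbatim Part I/II-basics/III/IV/V/VI/VII extract of the crux workfile `Cruxes/DualUnipotentThreeHalves/InitialForm.lean` rev 14;
# crit-7 g3 V40 δ-READ ✓ of rev 13, STAGE REQUEST; desk val-lit RULINGS #389/#391/#392 «LedgerTorus claim protocol»; hand val-port-3 g3 «CLAIM LedgerTorus» 00:52Z)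

PORT NOTE.  Decl texts VERBATIM BY NAME; namespaces as staged (`…Theorems.GrenetZeon.InitialForm.*`); the ONLY changes are one-line docstrings on helper lemmas the gate's `lint.docstring` requires (marked «docstring added in the port»), the 400-line-cap SPLIT into five
chained modules `GrenetZeonDualUnipotentThreeHalvesLongMassLedgerTorus{Initial, Curve, SlowCurve, Slow, ∅}.lean` (this file imports `GrenetZeonDualUnipotentThreeHalvesLongMassLedgerTorusCurve`) and these headers; `--supports stmt-ValiantsHypothesis-24318`
helper.  ALL CREDIT: val-idea-28 g5 (lens «degeneration – orbit-closure»).  HONEST STATUS (author's, verbatim in spirit): an INSTRUMENT — the normal form of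
(c)-certificates under a torus symmetry; proves NO case of (c) `SlowCore.LongMassSlowLawInv`, is NOT progress on (c); crux 24318 OPEN; VP ≠ VNP is NOT proved.
The author's full module docstring is reproduced in `GrenetZeonDualUnipotentThreeHalvesLongMassLedgerTorusInitial.lean`.
-/

set_option linter.dupNamespace false

noncomputable section

/-! # PART IV — THE MONOMIAL COUNT: with singleton weight classes a graded certificate is a COORDINATE subspace, so the graded kill is a COUNT

crit-7 V29-1: for ONE Sidon cocharacter every weight class off an exceptional coordinate set `Z` is a singleton; then a weight-graded `K`
contains the basis vector of every coordinate it uses off `Z`, hence `finrank K ≤ #Z + #{coordinates off Z whose basis vector is tame}`.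
So `hkill` of `not_flagCheap_of_graded` follows from the pure COUNT `#{e ∉ Z | tame e} + #Z ≤ (k+1)·n` (`not_flagCheap_of_count`);
the remaining debt for an unconditional `¬HeavyTopLaw` via `E(n)` is (α) typing `E(n)` as a `linPencil` with the support condition and a Sidon
cocharacter, and (β)(γ) the per-coordinate wildness (rigid words, Band Lemma′) that bounds the tame count — V29-4. -/

section MonomialCount

namespace Summit.ValiantsHypothesis.ValiantsHypothesis.Theorems.GrenetZeon.InitialForm

variable {ι : Type*} [DecidableEq ι]

/-- With singleton weight classes off `Z`, the weight projection of a coordinate `e ∉ Z` is the coordinate projection. -/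
theorem wtProj_eq_single (w : ι → ℕ) (Z : Finset ι) (hZ : ∀ e, e ∉ Z → ∀ e', w e' = w e → e' = e)
    {e : ι} (he : e ∉ Z) (s : ι → ℂ) : wtProj w (w e) s = s e • (Pi.single e (1 : ℂ) : ι → ℂ) := by
  funext e'
  by_cases h : e' = e
  · subst h; simp [wtProj]
  · have hw : w e' ≠ w e := fun hwe => h (hZ e he e' hwe)
    simp [wtProj, hw, h]

/-- **MONOMIAL COUNT.**  Let the weight classes off `Z` be singletons and let `Tame` be any predicate on coordinates.  If a weight-graded
subspace `K` has `finrank K > #{e ∉ Z | Tame e} + #Z`, then `K` contains the basis vector of a NON-tame coordinate off `Z`. -/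
theorem exists_wild_coordinate [Fintype ι] (w : ι → ℕ) (Z : Finset ι) (hZ : ∀ e, e ∉ Z → ∀ e', w e' = w e → e' = e)
    (Tame : ι → Prop) [DecidablePred Tame] (K : Submodule ℂ (ι → ℂ))
    (hgr : ∀ s ∈ K, ∀ c, wtProj w c s ∈ K)
    (hdim : (Finset.univ.filter fun e => e ∉ Z ∧ Tame e).card + Z.card < Module.finrank ℂ K) :
    ∃ e, e ∉ Z ∧ ¬ Tame e ∧ (Pi.single e (1 : ℂ) : ι → ℂ) ∈ K := by
  by_contra hno
  push Not at hno
  -- every element of `K` vanishes at the wild coordinates off `Z`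
  have hvan : ∀ s ∈ K, ∀ e, e ∉ Z → ¬ Tame e → s e = 0 := by
    intro s hs e he ht
    by_contra hse
    have hmem : wtProj w (w e) s ∈ K := hgr s hs (w e)
    rw [wtProj_eq_single w Z hZ he s] at hmem
    have : (Pi.single e (1 : ℂ) : ι → ℂ) ∈ K := by
      have h2 := K.smul_mem (s e)⁻¹ hmem
      rwa [smul_smul, inv_mul_cancel₀ hse, one_smul] at h2
    exact hno e he ht this
  -- restriction to the allowed coordinates is injective on `K`
  let A := {e : ι // e ∈ Z ∨ Tame e}
  let r : K →ₗ[ℂ] (A → ℂ) :=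
    { toFun := fun s a => (s : ι → ℂ) a.1
      map_add' := fun s t => by funext a; simp
      map_smul' := fun c s => by funext a; simp }
  have hr : Function.Injective r := by
    intro s t hst
    apply Subtype.ext
    funext e
    by_cases hA : e ∈ Z ∨ Tame e
    · exact congrFun hst ⟨e, hA⟩
    · push Not at hA
      rw [hvan s s.2 e hA.1 hA.2, hvan t t.2 e hA.1 hA.2]
  have hle : Module.finrank ℂ K ≤ Fintype.card A := by
    have := LinearMap.finrank_le_finrank_of_injective hr
    rwa [Module.finrank_fintype_fun_eq_card] at this
  have hcard : Fintype.card A ≤ (Finset.univ.filter fun e => e ∉ Z ∧ Tame e).card + Z.card := by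
    rw [Fintype.card_subtype]
    calc (Finset.univ.filter fun e => e ∈ Z ∨ Tame e).card
        ≤ ((Finset.univ.filter fun e => e ∉ Z ∧ Tame e) ∪ Z).card := by
          apply Finset.card_le_card
          intro e he
          simp only [Finset.mem_filter, Finset.mem_univ, true_and, Finset.mem_union] at he ⊢
          by_cases hz : e ∈ Z
          · exact Or.inr hz
          · rcases he with h | h
            · exact absurd h hz
            · exact Or.inl ⟨hz, h⟩
      _ ≤ (Finset.univ.filter fun e => e ∉ Z ∧ Tame e).card + Z.card := Finset.card_union_le _ _
  omega

end Summit.ValiantsHypothesis.ValiantsHypothesis.Theorems.GrenetZeon.InitialForm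

end MonomialCount

/-! # PART V — SLOW IS CLOSED ALONG POLYNOMIAL CURVES FOR ALGEBRAIC CERTIFICATE FAMILIES (power currency)

Part III instantiated to the `Slow` certificate of `Lines/slow_core.lean` (`deg_s (N(x+sv)^{n-1})_{ab} ≤ k`): the `s^e`-coefficients
are specialisations of UNIVERSAL polynomials `G d F x e a b ∈ MvPolynomial ι ℂ[X]` (LEMMA U `eval_G`: a universal line substitution
`Λ x` into `𝔸 = MvPolynomial (Fin 1) (MvPolynomial ι ℂ[X])`, specialised by `φ t v`; `Matrix.map_pow`, `MvPolynomial.coeff_map`), so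
`slow_curve_zero_of_algebraic_family`: along a polynomial curve `curve d F` (same text as `MassCut.curve`), an ALGEBRAIC family `N` of
directions that is `k`-slow for all `t` off a finite set and has generic dimension `> (k+1)·n` makes the member `t = 0` `Slow` with
budget `k` (conclusion = body of `SlowCoreLine.Slow` verbatim).  Honest: NOT the pointwise `MassCut.SlowClosedAlongCurves`. -/

noncomputable section

namespace Summit.ValiantsHypothesis.ValiantsHypothesis.Theorems.GrenetZeon.InitialForm.SlowCurve

open scoped Polynomial
open Summit.ValiantsHypothesis.ValiantsHypothesis.Cruxes.TwoDimCoefficients.DimTwoCases (AffMat IsAffine)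
open Summit.ValiantsHypothesis.ValiantsHypothesis.Theorems.GrenetZeon.RadicalSplit (lineSubst)
open Summit.ValiantsHypothesis.ValiantsHypothesis.Theorems.GrenetZeon.InitialForm.CurveClosure (ev ev_apply
  exists_limit_of_algebraic_family)

variable {n m : ℕ}

/-- The member `t` of the polynomial curve of pencils `F 0 + t F 1 + … + t^d F d` (= idea-26 `MassCut.curve`, same text). -/
def curve (d : ℕ) (F : ℕ → AffMat n m) (t : ℂ) : AffMat n m :=
  ∑ i ∈ Finset.range (d + 1), (t ^ i) • F i

/-- The universal coefficient ring: outer variable `s = X 0`, middle variables `V_e` (the direction), inner `t` (the curve parameter). -/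
abbrev 𝔸 (n : ℕ) : Type := MvPolynomial (Fin 1) (MvPolynomial (Fin n × Fin n) ℂ[X])

/-- `ℂ[X] → 𝔸`: the curve parameter as a constant. -/
def ψ₁ : ℂ[X] →+* 𝔸 n := (MvPolynomial.C).comp MvPolynomial.C

/-- `ℂ → 𝔸`. -/
def ψ₀ : ℂ →+* 𝔸 n := (ψ₁ (n := n)).comp Polynomial.C

/-- The UNIVERSAL line substitution `X_e ↦ x_e + V_e · s`. -/
def Λ (x : Fin n × Fin n → ℂ) : MvPolynomial (Fin n × Fin n) ℂ →+* 𝔸 n :=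
  MvPolynomial.eval₂Hom ψ₀ fun e => ψ₀ (x e) + ∑ t : Fin 1, MvPolynomial.C (MvPolynomial.X e) * MvPolynomial.X t

/-- Specialisation of the middle/inner variables: `V ↦ v`, `t ↦ t`. -/
def φ (t : ℂ) (v : Fin n × Fin n → ℂ) : MvPolynomial (Fin n × Fin n) ℂ[X] →+* ℂ :=
  MvPolynomial.eval₂Hom (Polynomial.evalRingHom t) v

/-- `φ_apply` — helper of this port (see the module docstring for its role). (docstring added in the port) -/
theorem φ_apply (t : ℂ) (v : Fin n × Fin n → ℂ) (G : MvPolynomial (Fin n × Fin n) ℂ[X]) :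
    φ t v G = MvPolynomial.eval v (MvPolynomial.map (Polynomial.evalRingHom t) G) := by
  rw [MvPolynomial.eval_map]; rfl

/-- `map_φ_ψ₁` — helper of this port (see the module docstring for its role). (docstring added in the port) -/
theorem map_φ_ψ₁ (t : ℂ) (v : Fin n × Fin n → ℂ) (g : ℂ[X]) :
    MvPolynomial.map (φ t v) (ψ₁ g) = MvPolynomial.C (g.eval t) := by
  simp [ψ₁, φ, MvPolynomial.map_C]

/-- `map_φ_ψ₀` — helper of this port (see the module docstring for its role). (docstring added in the port) -/
theorem map_φ_ψ₀ (t : ℂ) (v : Fin n × Fin n → ℂ) (c : ℂ) :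
    MvPolynomial.map (φ t v) (ψ₀ c) = MvPolynomial.C c := by
  simp [ψ₀, map_φ_ψ₁]

/-- `φ_X` — helper of this port (see the module docstring for its role). (docstring added in the port) -/
theorem φ_X (t : ℂ) (v : Fin n × Fin n → ℂ) (e : Fin n × Fin n) : φ t v (MvPolynomial.X e) = v e := by
  simp [φ]

/-- Specialising the universal substitution gives `lineSubst`. -/
theorem map_φ_comp_Λ (t : ℂ) (v x : Fin n × Fin n → ℂ) :
    (MvPolynomial.map (φ t v)).comp (Λ x) = (lineSubst x v : MvPolynomial (Fin n × Fin n) ℂ →+* MvPolynomial (Fin 1) ℂ) := by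
  apply MvPolynomial.ringHom_ext
  · intro c
    simp [Λ, map_φ_ψ₀, lineSubst]
  · intro e
    simp [Λ, map_φ_ψ₀, lineSubst, MvPolynomial.map_X, MvPolynomial.map_C, φ_X]

/-- `map_φ_Λ` — helper of this port (see the module docstring for its role). (docstring added in the port) -/
theorem map_φ_Λ (t : ℂ) (v x : Fin n × Fin n → ℂ) (P : MvPolynomial (Fin n × Fin n) ℂ) :
    MvPolynomial.map (φ t v) (Λ x P) = lineSubst x v P := by
  have := congrArg (fun h : MvPolynomial (Fin n × Fin n) ℂ →+* MvPolynomial (Fin 1) ℂ => h P) (map_φ_comp_Λ t v x)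
  simpa using this

/-- The universal curve along the universal line: entries in `𝔸`. -/
def univCurve (d : ℕ) (F : ℕ → AffMat n m) (x : Fin n × Fin n → ℂ) : Matrix (Fin m) (Fin m) (𝔸 n) :=
  ∑ i ∈ Finset.range (d + 1), (ψ₁ (n := n) (Polynomial.X ^ i)) • (F i).map (Λ x)

/-- Specialising the universal curve gives the curve member along the line. -/
theorem univCurve_map (d : ℕ) (F : ℕ → AffMat n m) (x : Fin n × Fin n → ℂ) (t : ℂ) (v : Fin n × Fin n → ℂ) :
    (univCurve d F x).map (MvPolynomial.map (φ t v)) = (curve d F t).map (lineSubst x v) := by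
  refine Matrix.ext fun a b => ?_
  simp only [univCurve, curve, Matrix.map_apply, Matrix.sum_apply, Matrix.smul_apply, smul_eq_mul, map_sum, map_mul,
    map_φ_ψ₁, map_φ_Λ, Polynomial.eval_pow, Polynomial.eval_X, MvPolynomial.smul_eq_C_mul, MvPolynomial.algHom_C,
    MvPolynomial.algebraMap_eq]

/-- The universal `s^e`-coefficient of an entry of the `(n-1)`-st power. -/
def G (d : ℕ) (F : ℕ → AffMat n m) (x : Fin n × Fin n → ℂ) (e : ℕ) (a b : Fin m) : MvPolynomial (Fin n × Fin n) ℂ[X] :=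
  MvPolynomial.coeff (Finsupp.single 0 e) (((univCurve d F x) ^ (n - 1)) a b)

/-- LEMMA U: specialising `G` computes the `s^e`-coefficient of the curve member along the line `x + s v`. -/
theorem eval_G (d : ℕ) (F : ℕ → AffMat n m) (x : Fin n × Fin n → ℂ) (e : ℕ) (a b : Fin m) (t : ℂ)
    (v : Fin n × Fin n → ℂ) :
    MvPolynomial.eval v (MvPolynomial.map (Polynomial.evalRingHom t) (G d F x e a b))
      = MvPolynomial.coeff (Finsupp.single 0 e) ((((curve d F t).map (lineSubst x v)) ^ (n - 1)) a b) := by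
  rw [← φ_apply, G, ← MvPolynomial.coeff_map, ← univCurve_map, ← Matrix.map_pow, Matrix.map_apply]

/-- Degree `≤ k` in `s` means the coefficients above `k` vanish (one variable). -/
theorem totalDegree_le_iff_coeff (P : MvPolynomial (Fin 1) ℂ) (k : ℕ) :
    P.totalDegree ≤ k ↔ ∀ e, k < e → MvPolynomial.coeff (Finsupp.single 0 e) P = 0 := by
  constructor
  · intro h e he
    by_contra hne
    have hmem : Finsupp.single (0 : Fin 1) e ∈ P.support := by simpa [MvPolynomial.mem_support_iff] using hne
    have := MvPolynomial.le_totalDegree hmem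
    simp at this
    omega
  · intro h
    rw [MvPolynomial.totalDegree]
    apply Finset.sup_le
    intro s hs
    have hs' : s = Finsupp.single 0 (s 0) := Finsupp.unique_single s
    have hle : s 0 ≤ k := by
      by_contra hlt
      push Not at hlt
      have := h (s 0) hlt
      rw [← hs'] at this
      exact (MvPolynomial.mem_support_iff.mp hs) this
    rw [hs']
    simpa using hle

/-- ★ **SLOW IS CLOSED ALONG POLYNOMIAL CURVES — ALGEBRAIC CERTIFICATE FAMILIES.**  Let `t ↦ curve d F t` be a polynomial curve of
pencils and `N ≤ (ι → ℂ[X])` an ALGEBRAIC family of directions (`ι = Fin n × Fin n`) of generic dimension `finrank ℂ[X] N > (k+1)·n`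
such that, for all `t` outside a finite set, every evaluated direction `ev t p` (`p ∈ N`) is `k`-slow for `curve d F t` along every
line.  Then the member `t = 0` is `Slow` (body of `SlowCoreLine.Slow` verbatim) with the same budget `k`.  (Part III + LEMMA U.)
NOT the pointwise `MassCut.SlowClosedAlongCurves`: that needs curve selection first (tier L). -/
theorem slow_curve_zero_of_algebraic_family (d : ℕ) (F : ℕ → AffMat n m) (k : ℕ)
    (N : Submodule ℂ[X] (Fin n × Fin n → ℂ[X])) (S : Finset ℂ)
    (hcert : ∀ t : ℂ, t ∉ S → ∀ p ∈ N, ∀ x : Fin n × Fin n → ℂ, ∀ a b : Fin m,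
      ((((curve d F t).map (lineSubst x (ev t p))) ^ (n - 1)) a b).totalDegree ≤ k)
    (hdim : (k + 1) * n < Module.finrank ℂ[X] N) :
    ∃ (K : Submodule ℂ (Fin n × Fin n → ℂ)) (k' : ℕ),
      (∀ x v : Fin n × Fin n → ℂ, v ∈ K → ∀ a b : Fin m, ((((curve d F 0).map (lineSubst x v)) ^ (n - 1)) a b).totalDegree ≤ k') ∧
      (k' + 1) * n < Module.finrank ℂ K := by
  classical
  -- the parameter set: everything off `S ∪ {0}`
  set T : Set ℂ := (↑(insert (0 : ℂ) S) : Set ℂ)ᶜ with hT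
  have hTinf : T.Infinite := (Finset.finite_toSet _).infinite_compl
  have hT0 : (0 : ℂ) ∉ T := by simp [hT]
  -- the family of universal coefficients above `k`
  set 𝓕 : Set (MvPolynomial (Fin n × Fin n) ℂ[X]) :=
    {H | ∃ x e a b, k < e ∧ H = G d F x e a b} with h𝓕
  have hS : ∀ t ∈ T, ∀ p ∈ N, ∀ H ∈ 𝓕,
      MvPolynomial.eval (ev t p) (MvPolynomial.map (Polynomial.evalRingHom t) H) = 0 := by
    intro t ht p hp H hH
    obtain ⟨x, e, a, b, he, rfl⟩ := hH
    have htS : t ∉ S := fun h => ht (by simp [h])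
    rw [eval_G]
    exact (totalDegree_le_iff_coeff _ k).mp (hcert t htS p hp x a b) e he
  obtain ⟨K₀, hK₀dim, -, hK₀⟩ := exists_limit_of_algebraic_family N 𝓕 T hTinf hT0 hS
  refine ⟨K₀, k, fun x v hv a b => ?_, by rw [hK₀dim]; exact hdim⟩
  rw [totalDegree_le_iff_coeff]
  intro e he
  rw [← eval_G d F x e a b 0 v]
  exact hK₀ v hv _ ⟨x, e, a, b, he, rfl⟩

end Summit.ValiantsHypothesis.ValiantsHypothesis.Theorems.GrenetZeon.InitialForm.SlowCurve
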